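/-
VALUE = THEOREM (the sign character of O₃(𝔽_p) on isotropic lines and its value on reflections,
for the all-`p` reflection-class certificate), NOT summit progress (cell b2b-lgcu-borel, gen 24);
the crux item stmt-MatrixMultiplication-14079 is untouched.
-/
import Mathlib
import Literature.NumberTheory.EllipticCurves.BinaryQuarticDiscriminantFpCountProofs
import Summits.MatrixMultiplication.MatrixMultiplication.Theorems.SubgroupIdentityDesigns.Negative.ReflectionClassCertificate
import Summits.MatrixMultiplication.MatrixMultiplication.Theorems.SubgroupIdentityDesigns.Negative.ReflectionClassPlane
import Summits.MatrixMultiplication.MatrixMultiplication.Theorems.SubgroupIdentityDesigns.Negative.ReflectionClassIsoLines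

/-!
# The sign character `ι` of `O₃(𝔽_p)` and `ι(R_b) = χ(Q b)`

VALUE = THEOREM (generic in the odd prime `p`), NOT summit progress; the crux item
stmt-MatrixMultiplication-14079 is untouched and remains open.

Layer F3b of the all-`p` proof of the unified reflection-class certificate (ORACLE-g24 §G24-1 L1,
§G24-2 F3).  The substitute for the spinor norm used to pin down the reflection class groups:
* `O3 p ≤ GL₃(𝔽_p)` — the isometries `gᵀ g = 1` of `Q(v) = v ⬝ v`; they permute the isotropic
  lines `IL p` (lines `ℓ` with `Q(ℓ.rep) = 0`; a `MulAction`), and `iota : O3 p →* ℤˣ` is the sign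
  of that permutation;
* `iota_reflO : ι(R_b) = χ(Q b)` — `R_b` is an involution of the `p + 1` isotropic lines fixing
  exactly the `1 + χ(−Q b)` of them inside `b^⊥` (`ReflectionClassIsoLines`), so it is a product
  of `(p − χ(−Q b))/2` transpositions, and `(−1)^{(p − χ(−Q b))/2} = χ(−1)χ(−Q b) = χ(Q b)`;
* `classGroup_sign : k ∈ classGroup p σ → k ∈ O₃ ∧ ∃ n, ι k = ε_σⁿ ∧ det k = (−1)ⁿ`
  (`ε_σ = +1` for the square class, `−1` for the non-square class) — the homomorphism
  `θ = ι · ε_σ^{[det = −1]}` kills the class group, which separates it from the other class and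
  from mixed products `R_a R_b`, `χ(Q a) ≠ χ(Q b)` (`iota_of_mem_classGroup`).
-/

set_option linter.dupNamespace false

open scoped BigOperators Matrix LinearAlgebra.Projectivization

namespace Summit.MatrixMultiplication.MatrixMultiplication.Theorems.SubgroupIdentityDesigns.Negative
namespace ReflectionClassIsoSign

open Summit.MatrixMultiplication.MatrixMultiplication.Theorems.LieRankDesigns.Negative (GLm Mat)
open ReflectionClassCertificate (V classGroup)
open NonsquareReflections (reflMat refl coe_refl reflMat_mul_self reflMat_mulVec det_reflMat)
open ReflectionClassPlane (refl_dot refl_dot_self)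
open ReflectionClassIsoLines (card_isoLines card_isoLines_perp)
open Literature.NumberTheory.EllipticCurves.BinaryQuartic (two_ne_zero_zmod)

variable {p : ℕ} [hp : Fact p.Prime]

/-! ## The orthogonal group `O₃(𝔽_p)` -/

/-- `O₃(𝔽_p)`: the `g ∈ GL₃(𝔽_p)` with `gᵀ g = 1`. -/
def O3 (p : ℕ) [Fact p.Prime] : Subgroup (GLm p 3) where
  carrier := {g | ((g : Mat p 3))ᵀ * (g : Mat p 3) = 1}
  mul_mem' {a b} ha hb := by
    simp only [Set.mem_setOf_eq, Units.val_mul, Matrix.transpose_mul] at *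
    rw [Matrix.mul_assoc, ← Matrix.mul_assoc ((a : Mat p 3))ᵀ, ha, Matrix.one_mul, hb]
  one_mem' := by simp
  inv_mem' {a} ha := by
    simp only [Set.mem_setOf_eq] at *
    have h1 : (a : Mat p 3) * ((a : Mat p 3))ᵀ = 1 := mul_eq_one_comm.mp ha
    have hinv : ((a⁻¹ : GLm p 3) : Mat p 3) = ((a : Mat p 3))ᵀ := by
      rw [Matrix.coe_units_inv]; exact Matrix.inv_eq_left_inv ha
    rw [hinv, Matrix.transpose_transpose, h1]

/-- Membership in `O₃`. -/
theorem mem_O3 {g : GLm p 3} : g ∈ O3 p ↔ ((g : Mat p 3))ᵀ * (g : Mat p 3) = 1 := Iff.rfl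

/-- `R_b` is symmetric. -/
theorem reflMat_transpose (b : V p) : (reflMat b)ᵀ = reflMat b := by
  rw [reflMat, Matrix.transpose_sub, Matrix.transpose_one, Matrix.transpose_vecMulVec,
    Matrix.vecMulVec_smul, Matrix.smul_vecMulVec]

/-- Reflections are isometries. -/
theorem refl_mem_O3 (b : V p) : refl b ∈ O3 p := by
  rw [mem_O3, coe_refl, reflMat_transpose, reflMat_mul_self]

/-- Isometries have `det² = 1`. -/
theorem det_mul_det_of_mem {g : GLm p 3} (hg : g ∈ O3 p) :
    (g : Mat p 3).det * (g : Mat p 3).det = 1 := by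
  have h := congrArg Matrix.det (mem_O3.mp hg)
  rwa [Matrix.det_mul, Matrix.det_transpose, Matrix.det_one] at h

/-- Isometries preserve the dot product. -/
theorem mulVec_dot_mulVec {g : GLm p 3} (hg : g ∈ O3 p) (v w : V p) :
    ((g : Mat p 3) *ᵥ v) ⬝ᵥ ((g : Mat p 3) *ᵥ w) = v ⬝ᵥ w := by
  rw [Matrix.dotProduct_mulVec, ← Matrix.vecMul_transpose, Matrix.vecMul_vecMul, mem_O3.mp hg,
    Matrix.vecMul_one]

/-! ## Isotropic lines and the action of `O₃` -/

/-- Lines are compared classically. -/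
noncomputable instance instDecEqLines : DecidableEq (ℙ (ZMod p) (V p)) := Classical.decEq _

/-- Isotropy of the line through `v` (a line is isotropic if `Q` vanishes on it, tested at the
chosen representative `ℓ.rep`) is isotropy of `v`. -/
theorem isoLine_mk {v : V p} (hv : v ≠ 0) :
    (Projectivization.mk (ZMod p) v hv).rep ⬝ᵥ (Projectivization.mk (ZMod p) v hv).rep = 0 ↔
      v ⬝ᵥ v = 0 := by
  obtain ⟨a, ha⟩ := Projectivization.exists_smul_eq_mk_rep (ZMod p) v hv
  rw [← ha, Units.smul_def, smul_dotProduct, dotProduct_smul, smul_eq_mul, smul_eq_mul,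
    ← mul_assoc]
  exact ⟨fun h => (mul_eq_zero.mp h).resolve_left (mul_ne_zero a.ne_zero a.ne_zero),
    fun h => by rw [h, mul_zero]⟩

/-- A condition at `ℓ.rep` orthogonal to a fixed `b` descends from any representative. -/
theorem rep_dot_eq_zero_iff {v : V p} (hv : v ≠ 0) (b : V p) :
    (Projectivization.mk (ZMod p) v hv).rep ⬝ᵥ b = 0 ↔ v ⬝ᵥ b = 0 := by
  obtain ⟨a, ha⟩ := Projectivization.exists_smul_eq_mk_rep (ZMod p) v hv
  rw [← ha, Units.smul_def, smul_dotProduct, smul_eq_mul]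
  exact ⟨fun h => (mul_eq_zero.mp h).resolve_left a.ne_zero, fun h => by rw [h, mul_zero]⟩

/-- Isometries preserve isotropy of lines. -/
theorem isoLine_smul {g : GLm p 3} (hg : g ∈ O3 p) (ℓ : ℙ (ZMod p) (V p)) :
    (g • ℓ).rep ⬝ᵥ (g • ℓ).rep = 0 ↔ ℓ.rep ⬝ᵥ ℓ.rep = 0 := by
  induction ℓ using Projectivization.ind with
  | h v hv =>
    rw [Projectivization.smul_mk, isoLine_mk, isoLine_mk]
    exact Iff.of_eq (congrArg (· = 0) (mulVec_dot_mulVec hg v v))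

/-- The isotropic lines: the conic `Q = 0` of `ℙ²(𝔽_p)`. -/
abbrev IL (p : ℕ) [Fact p.Prime] : Type := {ℓ : ℙ (ZMod p) (V p) // ℓ.rep ⬝ᵥ ℓ.rep = 0}

/-- `O₃(𝔽_p)` permutes the isotropic lines. -/
instance instMulActionIL : MulAction (O3 p) (IL p) where
  smul g ℓ := ⟨(g : GLm p 3) • ℓ.1, (isoLine_smul g.2 ℓ.1).mpr ℓ.2⟩
  one_smul ℓ := Subtype.ext (one_smul (GLm p 3) ℓ.1)
  mul_smul a b ℓ := Subtype.ext (mul_smul (a : GLm p 3) b ℓ.1)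

/-- The action, on underlying lines. -/
theorem coe_smul (g : O3 p) (ℓ : IL p) :
    ((g • ℓ : IL p) : ℙ (ZMod p) (V p)) = (g : GLm p 3) • ℓ.1 :=
  rfl

/-- **The sign character** `ι : O₃(𝔽_p) → {±1}`, the sign of the permutation of isotropic lines. -/
noncomputable def iota : O3 p →* ℤˣ :=
  (Equiv.Perm.sign : Equiv.Perm (IL p) →* ℤˣ).comp (MulAction.toPermHom (O3 p) (IL p))

/-- `ι g` is the sign of `g` acting on `IL p`. -/
theorem iota_apply (g : O3 p) :
    iota g = Equiv.Perm.sign (MulAction.toPerm g : Equiv.Perm (IL p)) := rfl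

/-- There are `p + 1` isotropic lines. -/
theorem card_IL (hp2 : p ≠ 2) : (Fintype.card (IL p) : ℤ) = p + 1 := by
  rw [Fintype.card_subtype]
  convert card_isoLines (p := p) hp2 using 3

/-! ## `ι` of a reflection -/

section Reflection

variable {b : V p}

/-- The reflection `R_b` as an element of `O₃`. -/
def reflO (b : V p) : O3 p := ⟨refl b, refl_mem_O3 b⟩

/-- Underlying matrix of `reflO b`. -/
theorem coe_reflO (b : V p) : (((reflO b : O3 p) : GLm p 3) : Mat p 3) = reflMat b := rfl

/-- `R_b² = 1` in `O₃`. -/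
theorem reflO_mul_self (b : V p) : reflO b * reflO b = 1 :=
  Subtype.ext (Units.ext (by simp [reflO, reflMat_mul_self]))

/-- **Fixed isotropic lines of `R_b`** (`b` anisotropic, `p` odd): exactly those inside `b^⊥`. -/
theorem reflO_smul_eq_iff (hp2 : p ≠ 2) (hb : b ⬝ᵥ b ≠ 0) (ℓ : IL p) :
    reflO b • ℓ = ℓ ↔ (ℓ : ℙ (ZMod p) (V p)).rep ⬝ᵥ b = 0 := by
  obtain ⟨ℓ, hℓ⟩ := ℓ
  rw [Subtype.ext_iff, coe_smul]
  induction ℓ using Projectivization.ind with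
  | h v hv =>
    have hvv : v ⬝ᵥ v = 0 := (isoLine_mk hv).mp hℓ
    rw [rep_dot_eq_zero_iff hv, Projectivization.smul_mk, Projectivization.mk_eq_mk_iff]
    change (∃ a : (ZMod p)ˣ, a • v = reflMat b *ᵥ v) ↔ _
    constructor
    · rintro ⟨a, ha⟩
      have h := congrArg (fun w => w ⬝ᵥ v) ha
      simp only [Units.smul_def, smul_dotProduct, smul_eq_mul, hvv, mul_zero, refl_dot, zero_sub,
        zero_eq_neg] at h
      have h2 : (2 : ZMod p) / (b ⬝ᵥ b) ≠ 0 := div_ne_zero (two_ne_zero_zmod hp2) hb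
      rcases mul_eq_zero.mp h with h | h
      · rcases mul_eq_zero.mp h with h | h
        · exact absurd h h2
        · rw [dotProduct_comm]; exact h
      · rw [dotProduct_comm]; exact h
    · intro h
      exact ⟨1, by rw [one_smul, reflMat_mulVec b v (by rwa [dotProduct_comm])]⟩

/-- The sign of an involution of the isotropic lines is `(−1)^{#moved / 2}` (stated in `ℤ`; the
`ℤˣ`-power instance `Int.instUnitsPow` is avoided on purpose). -/
theorem sign_of_mul_self {τ : Equiv.Perm (IL p)} (h : τ * τ = 1) :
    ((Equiv.Perm.sign τ : ℤˣ) : ℤ) = (-1 : ℤ) ^ (τ.support.card / 2) := by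
  by_cases h1 : τ = 1
  · subst h1; simp
  · have ho : orderOf τ = 2 := orderOf_eq_prime (by rw [pow_two]; exact h) h1
    obtain ⟨n, hn⟩ := Equiv.Perm.cycleType_prime_order (σ := τ) (by rw [ho]; exact Nat.prime_two)
    rw [ho] at hn
    rw [Equiv.Perm.sign_of_cycleType, ← Equiv.Perm.sum_cycleType, hn, Multiset.sum_replicate,
      Multiset.card_replicate, smul_eq_mul, Nat.mul_div_cancel _ two_pos, Units.val_pow_eq_pow_val,
      Units.val_neg, Units.val_one, pow_add, mul_comm (n + 1) 2, pow_mul, neg_one_sq, one_pow,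
      one_mul]

/-- The number of isotropic lines moved by `R_b` is `p − χ(−Q b)`. -/
theorem card_support_reflO (hp2 : p ≠ 2) (hb : b ⬝ᵥ b ≠ 0) :
    ((MulAction.toPerm (reflO b) : Equiv.Perm (IL p)).support.card : ℤ) =
      p - quadraticChar (ZMod p) (-(b ⬝ᵥ b)) := by
  classical
  have hsupp : (MulAction.toPerm (reflO b) : Equiv.Perm (IL p)).support =
      Finset.univ.filter fun ℓ : IL p => ¬ ((ℓ : ℙ (ZMod p) (V p)).rep ⬝ᵥ b = 0) := by
    ext ℓ
    rw [Equiv.Perm.mem_support, MulAction.toPerm_apply, Finset.mem_filter, Ne,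
      reflO_smul_eq_iff hp2 hb]
    simp
  have hfix : ((Finset.univ.filter fun ℓ : IL p => (ℓ : ℙ (ZMod p) (V p)).rep ⬝ᵥ b = 0).card : ℤ)
      = 1 + quadraticChar (ZMod p) (-(b ⬝ᵥ b)) := by
    rw [← card_isoLines_perp hp2 hb, ← Finset.card_map (Function.Embedding.subtype _)]
    congr 2
    ext ℓ
    simp only [Finset.mem_map, Finset.mem_filter, Finset.mem_univ, true_and,
      Function.Embedding.coe_subtype]
    constructor
    · rintro ⟨⟨ℓ', hI⟩, hq, rfl⟩
      exact ⟨hI, hq⟩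
    · rintro ⟨hI, hq⟩
      exact ⟨⟨ℓ, hI⟩, hq, rfl⟩
  have hsum := Finset.card_filter_add_card_filter_not
    (s := (Finset.univ : Finset (IL p))) (fun ℓ : IL p => (ℓ : ℙ (ZMod p) (V p)).rep ⬝ᵥ b = 0)
  rw [Finset.card_univ] at hsum
  have hsum' : ((Finset.univ.filter fun ℓ : IL p => (ℓ : ℙ (ZMod p) (V p)).rep ⬝ᵥ b = 0).card : ℤ)
      + ((Finset.univ.filter fun ℓ : IL p => ¬ ((ℓ : ℙ (ZMod p) (V p)).rep ⬝ᵥ b = 0)).card : ℤ)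
      = Fintype.card (IL p) := by exact_mod_cast hsum
  rw [hfix, card_IL hp2] at hsum'
  rw [hsupp]
  convert (show ((Finset.univ.filter fun ℓ : IL p =>
      ¬ ((ℓ : ℙ (ZMod p) (V p)).rep ⬝ᵥ b = 0)).card : ℤ) = p - quadraticChar (ZMod p) (-(b ⬝ᵥ b))
    by linear_combination hsum') using 4

/-- `χ(−1) = (−1)^{⌊p/2⌋}` over `𝔽_p` (`p` odd). -/
theorem chi_neg_one_eq_pow (hp2 : p ≠ 2) :
    quadraticChar (ZMod p) (-1) = (-1) ^ (p / 2) := by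
  have hF : ringChar (ZMod p) ≠ 2 := by rw [ZMod.ringChar_zmod_n]; exact hp2
  have hodd : p % 2 = 1 := Nat.odd_iff.mp (hp.out.odd_of_ne_two hp2)
  rw [quadraticChar_neg_one hF, ZMod.card, ZMod.χ₄_eq_neg_one_pow hodd]

/-- **`ι(R_b) = χ(Q b)`** for anisotropic `b` (`p` odd). -/
theorem iota_reflO (hp2 : p ≠ 2) (hb : b ⬝ᵥ b ≠ 0) :
    ((iota (reflO b) : ℤˣ) : ℤ) = quadraticChar (ZMod p) (b ⬝ᵥ b) := by
  have hinv : (MulAction.toPerm (reflO b) : Equiv.Perm (IL p)) * MulAction.toPerm (reflO b) = 1 := by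
    rw [← MulAction.toPermHom_apply, ← map_mul, reflO_mul_self, map_one]
  have hodd : p % 2 = 1 := Nat.odd_iff.mp (hp.out.odd_of_ne_two hp2)
  have hχb : quadraticChar (ZMod p) (b ⬝ᵥ b) =
      quadraticChar (ZMod p) (-1) * quadraticChar (ZMod p) (-(b ⬝ᵥ b)) := by
    rw [← map_mul]; congr 1; ring
  rw [iota_apply, sign_of_mul_self hinv, hχb, chi_neg_one_eq_pow hp2]
  have hcard := card_support_reflO hp2 hb
  rcases quadraticChar_dichotomy (neg_ne_zero.mpr hb) with h | h <;> rw [h] at hcard ⊢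
  · have hc : (MulAction.toPerm (reflO b) : Equiv.Perm (IL p)).support.card = p - 1 := by omega
    rw [hc, mul_one, show (p - 1) / 2 = p / 2 by omega]
  · have hc : (MulAction.toPerm (reflO b) : Equiv.Perm (IL p)).support.card = p + 1 := by omega
    rw [hc, mul_neg, mul_one, show (p + 1) / 2 = p / 2 + 1 by omega, pow_succ]
    ring

end Reflection

/-! ## The class groups lie in the kernel of `θ = ι · ε^{[det = −1]}` -/

/-- The sign of the class `σ`: `+1` for square norms, `−1` for non-square norms. -/
def eps (σ : Bool) : ℤ := if σ then 1 else -1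

/-- `ε_σ² = 1`. -/
theorem eps_sq (σ : Bool) : eps σ ^ 2 = 1 := by
  cases σ <;> simp [eps]

/-- `ι(R_b) = ε_σ` for a reflection of the class `σ`. -/
theorem iota_reflO_class (hp2 : p ≠ 2) {σ : Bool} {b : V p} (hb : b ⬝ᵥ b ≠ 0)
    (hσ : decide (IsSquare (b ⬝ᵥ b)) = σ) : ((iota (reflO b) : ℤˣ) : ℤ) = eps σ := by
  rw [iota_reflO hp2 hb, eps]
  subst hσ
  by_cases hs : IsSquare (b ⬝ᵥ b)
  · rw [(quadraticChar_one_iff_isSquare hb).mpr hs]; simp [hs]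
  · rw [(quadraticChar_neg_one_iff_not_isSquare).mpr hs]; simp [hs]

/-- **The class group is controlled by `ι` and `det`:** every `k ∈ classGroup p σ` is an isometry
with `ι(k) = ε_σⁿ` and `det k = (−1)ⁿ` for a common `n` (the number of generators used). -/
theorem classGroup_sign (hp2 : p ≠ 2) (σ : Bool) {k : GLm p 3} (hk : k ∈ classGroup p σ) :
    ∃ hO : k ∈ O3 p, ∃ n : ℕ,
      ((iota ⟨k, hO⟩ : ℤˣ) : ℤ) = eps σ ^ n ∧ (k : Mat p 3).det = (-1) ^ n := by
  induction hk using Subgroup.closure_induction with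
  | mem x hx =>
    obtain ⟨b, hb, hσ, rfl⟩ := hx
    exact ⟨refl_mem_O3 b, 1, by rw [pow_one]; exact iota_reflO_class hp2 hb hσ,
      by rw [pow_one, coe_refl, det_reflMat b hb]⟩
  | one =>
    exact ⟨one_mem _, 0, by rw [pow_zero, show (⟨1, one_mem _⟩ : O3 p) = 1 from rfl, map_one,
      Units.val_one], by simp⟩
  | mul x y hx hy ihx ihy =>
    obtain ⟨hOx, m, hιx, hdx⟩ := ihx
    obtain ⟨hOy, n, hιy, hdy⟩ := ihy
    refine ⟨mul_mem hOx hOy, m + n, ?_, ?_⟩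
    · have : (⟨x * y, mul_mem hOx hOy⟩ : O3 p) = ⟨x, hOx⟩ * ⟨y, hOy⟩ := rfl
      rw [this, map_mul, Units.val_mul, hιx, hιy, pow_add]
    · rw [Units.val_mul, Matrix.det_mul, hdx, hdy, pow_add]
  | inv x hx ih =>
    obtain ⟨hO, n, hι, hd⟩ := ih
    refine ⟨inv_mem hO, n, ?_, ?_⟩
    · have h1 : (⟨x⁻¹, inv_mem hO⟩ : O3 p) = (⟨x, hO⟩ : O3 p)⁻¹ := rfl
      have h2 : iota (⟨x, hO⟩ : O3 p) * iota ⟨x, hO⟩ = 1 := by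
        apply Units.val_injective
        rw [Units.val_mul, hι, Units.val_one, ← pow_add, ← two_mul, pow_mul, eps_sq, one_pow]
      rw [h1, map_inv, inv_eq_of_mul_eq_one_right h2, hι]
    · have h1 : ((x⁻¹ : GLm p 3) : Mat p 3).det * (x : Mat p 3).det = 1 := by
        rw [← Matrix.det_mul, ← Units.val_mul, inv_mul_cancel, Units.val_one, Matrix.det_one]
      have h2 : ((-1 : ZMod p) ^ n) * ((-1 : ZMod p) ^ n) = 1 := by
        rw [← pow_add, ← two_mul, pow_mul, neg_one_sq, one_pow]
      rw [hd] at h1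
      exact mul_right_cancel₀ (pow_ne_zero n (neg_ne_zero.mpr one_ne_zero)) (h1.trans h2.symm)

/-- **Separation.**  A proper element of a class group acts evenly on the isotropic lines, an
improper one with the sign `ε_σ` (`p` odd). -/
theorem iota_of_mem_classGroup (hp2 : p ≠ 2) (σ : Bool) {k : GLm p 3}
    (hk : k ∈ classGroup p σ) :
    ∃ hO : k ∈ O3 p, ((k : Mat p 3).det = 1 ∧ iota ⟨k, hO⟩ = 1) ∨
      ((k : Mat p 3).det = -1 ∧ ((iota ⟨k, hO⟩ : ℤˣ) : ℤ) = eps σ) := by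
  obtain ⟨hO, n, hι, hd⟩ := classGroup_sign hp2 σ hk
  refine ⟨hO, ?_⟩
  rcases Nat.even_or_odd n with ⟨k, rfl⟩ | ⟨k, rfl⟩
  · left
    rw [← two_mul, pow_mul, neg_one_sq, one_pow] at hd
    rw [← two_mul, pow_mul, eps_sq, one_pow, Units.val_eq_one] at hι
    exact ⟨hd, hι⟩
  · right
    rw [pow_succ, pow_mul, neg_one_sq, one_pow, one_mul] at hd
    rw [pow_succ, pow_mul, eps_sq, one_pow, one_mul] at hι
    exact ⟨hd, hι⟩

end ReflectionClassIsoSign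
end Summit.MatrixMultiplication.MatrixMultiplication.Theorems.SubgroupIdentityDesigns.Negative
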